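import Summits.CriticalPhenomena.PercolationContinuityZ3.Theorems.SahiMasterFamilyThreePartitionPairwiseMeetCertA
import Summits.CriticalPhenomena.PercolationContinuityZ3.Theorems.SahiMasterFamilyThreePartitionPairwiseMeetCertB
import HarnessLib

/-!
# The PAIRWISE-ZERO-MEET STEP of twisted three-partition positivity at COMB level (unit `prim-master-conj`, gen 34;
# `--supports stmt-CriticalPhenomena-4575`)

Memo `run/shared/lean/prim/prim-l12/prim-master-conj/POINTWISE.md` §35.  **THEOREM (`threePartNT_nonneg_of_pairwiseMeet`).**  Let `𝒰, 𝒱, 𝒲`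
be up-sets, `e` a coordinate, `τ` a twist, with sections `𝒳⁰ = {T | T ∖ e ∈ 𝒳}`, `𝒳¹ = {T | T ∪ e ∈ 𝒳}` (lifted `e`-free to `ι`).  If
  `𝒰⁰ ∩ 𝒱⁰ ⊆ 𝒲¹`,  `𝒰⁰ ∩ 𝒲⁰ ⊆ 𝒱¹`,  `𝒱⁰ ∩ 𝒲⁰ ⊆ 𝒰¹`
(no set lies in two deletion sections while its `e`-augmentation misses the third family) and seven `e`-free threshold-section triples
(the deletion and contraction minors among them; listed in the statement, read by `mem_thrSet`) have `N_τ ≥ 0`, then `threePartNT τ 𝒰 𝒱 𝒲 ≥ 0`.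
This class CONTAINS the common-core class (`𝒰_i⁰ ⊆ ⋂ 𝒰_j¹`) and the cyclic class (`𝒰⁰⊆𝒱¹, 𝒱⁰⊆𝒲¹, 𝒲⁰⊆𝒰¹`) of `…CommonCoreCyclic`, and is a
MAXIMAL certifiable product class of the gen-33/34 bank (LP census kit j208583/j209019: every one-type enlargement, and each single
inclusion alone, has a pseudo-count).  Proof: `threePartNT_nonneg_of_cert` with the certificates of `…PairwiseMeetCertA/B`; the
realised-type hypothesis is discharged from the three inclusions (`pm_real`).  No `sorry`, standard axioms, nothing conditional beyond the
displayed IH hypotheses.  HONEST LABEL: a class STEP, not three-partition positivity. [this work]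
-/

noncomputable section

open Finset
open scoped symmDiff Classical

namespace Summit.CriticalPhenomena.PercolationContinuityZ3.Theorems.ThreePartition

namespace TypedSlice

section PMMain

variable {ι : Type*} [Fintype ι] {𝒰 𝒱 𝒲 : Set (Set ι)} (e : ι) (τ : Set ι)

/-- **Product-class step `pm0`**: if at `e` the triple realises only types of the class (mask `116391679`; `hreal`) and the listed
`e`-free threshold triples have nonnegative twisted functional, then `threePartNT τ 𝒰 𝒱 𝒲 ≥ 0` (LP certificates of gen 34,
kit j208583, exactified; kernel-checked). [this work] -/
theorem threePartNT_nonneg_of_pm0 (h𝒰 : IsUpperSet 𝒰) (h𝒱 : IsUpperSet 𝒱) (h𝒲 : IsUpperSet 𝒲)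
    (hreal : ∀ w : Set ι, inM 116391679 (typ 𝒰 𝒱 𝒲 e w) = true)
    (hN1 : 0 ≤ threePartNT τ (thrSet 𝒰 𝒱 𝒲 e (mk 0 0 1)) (thrSet 𝒰 𝒱 𝒲 e (mk 0 0 2)) (thrSet 𝒰 𝒱 𝒲 e (mk 2 2 0)))
    (hN2 : 0 ≤ threePartNT τ (thrSet 𝒰 𝒱 𝒲 e (mk 0 0 1)) (thrSet 𝒰 𝒱 𝒲 e (mk 0 1 0)) (thrSet 𝒰 𝒱 𝒲 e (mk 1 0 0)))
    (hN3 : 0 ≤ threePartNT τ (thrSet 𝒰 𝒱 𝒲 e (mk 0 0 2)) (thrSet 𝒰 𝒱 𝒲 e (mk 0 2 0)) (thrSet 𝒰 𝒱 𝒲 e (mk 2 0 0)))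
    (hN4 : 0 ≤ threePartNT τ (thrSet 𝒰 𝒱 𝒲 e (mk 0 1 0)) (thrSet 𝒰 𝒱 𝒲 e (mk 0 2 2)) (thrSet 𝒰 𝒱 𝒲 e (mk 2 0 1)))
    (hN5 : 0 ≤ threePartNT τ (thrSet 𝒰 𝒱 𝒲 e (mk 0 2 0)) (thrSet 𝒰 𝒱 𝒲 e (mk 1 0 0)) (thrSet 𝒰 𝒱 𝒲 e (mk 2 0 2)))
    (hN6 : 0 ≤ threePartNT τ (thrSet 𝒰 𝒱 𝒲 e (mk 0 0 2)) (thrSet 𝒰 𝒱 𝒲 e (mk 0 1 0)) (thrSet 𝒰 𝒱 𝒲 e (mk 2 2 0)))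
    (hN7 : 0 ≤ threePartNT τ (thrSet 𝒰 𝒱 𝒲 e (mk 0 1 0)) (thrSet 𝒰 𝒱 𝒲 e (mk 0 2 2)) (thrSet 𝒰 𝒱 𝒲 e (mk 2 0 0))) :
    0 ≤ threePartNT τ 𝒰 𝒱 𝒲 := by
  by_cases he : e ∈ τ
  · refine threePartNT_nonneg_of_cert 𝒰 𝒱 𝒲 e τ h𝒰 h𝒱 h𝒲 (d := 6) (by norm_num) (L := pm0BL) (I := pm0BI)
      (cls := inM 116391679) pm0B_ok ?_ hreal ?_
    · rw [decide_eq_true he]; exact pm0B_check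
    · intro p hp
      simp only [pm0BI, List.mem_cons, List.not_mem_nil, or_false] at hp
      rcases hp with rfl | rfl | rfl
      · exact hN2
      · exact hN6
      · exact hN7
  · refine threePartNT_nonneg_of_cert 𝒰 𝒱 𝒲 e τ h𝒰 h𝒱 h𝒲 (d := 325380) (by norm_num) (L := pm0AL) (I := pm0AI)
      (cls := inM 116391679) pm0A_ok ?_ hreal ?_
    · rw [decide_eq_false he]; exact pm0A_check
    · intro p hp
      simp only [pm0AI, List.mem_cons, List.not_mem_nil, or_false] at hp
      rcases hp with rfl | rfl | rfl | rfl | rfl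
      · exact hN1
      · exact hN2
      · exact hN3
      · exact hN4
      · exact hN5



/-- The 27 values of the class mask: a type is in the PAIRWISE-ZERO-MEET class iff it is not one of `(2,2,0), (2,0,2), (0,2,2)`. [this work] -/
theorem pm_mask_iff (t : Ty) : inM 116391679 t = true ↔ ¬ (t = mk 2 2 0 ∨ t = mk 2 0 2 ∨ t = mk 0 2 2) := by
  revert t; decide

omit [Fintype ι] in
/-- Under the three pairwise inclusions every realised type is in the class. [this work] -/
theorem pm_real (h𝒰 : IsUpperSet 𝒰) (h𝒱 : IsUpperSet 𝒱) (h𝒲 : IsUpperSet 𝒲)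
    (hUV : ∀ T : Set ι, T \ {e} ∈ 𝒰 → T \ {e} ∈ 𝒱 → insert e T ∈ 𝒲)
    (hUW : ∀ T : Set ι, T \ {e} ∈ 𝒰 → T \ {e} ∈ 𝒲 → insert e T ∈ 𝒱)
    (hVW : ∀ T : Set ι, T \ {e} ∈ 𝒱 → T \ {e} ∈ 𝒲 → insert e T ∈ 𝒰) (w : Set ι) :
    inM 116391679 (typ 𝒰 𝒱 𝒲 e w) = true := by
  rw [pm_mask_iff]
  have h2U := tyAt_eq_two_iff 𝒰 e w
  have h2V := tyAt_eq_two_iff 𝒱 e w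
  have h2W := tyAt_eq_two_iff 𝒲 e w
  have h1U := one_le_tyAt_iff h𝒰 e w
  have h1V := one_le_tyAt_iff h𝒱 e w
  have h1W := one_le_tyAt_iff h𝒲 e w
  rintro (h | h | h) <;> simp only [typ, mk, Prod.mk.injEq] at h <;> obtain ⟨ha, hb, hc⟩ := h
  · have := h1W.2 (hUV w (h2U.1 ha) (h2V.1 hb)); rw [hc] at this; exact absurd this (by decide)
  · have := h1V.2 (hUW w (h2U.1 ha) (h2W.1 hc)); rw [hb] at this; exact absurd this (by decide)
  · have := h1U.2 (hVW w (h2V.1 hb) (h2W.1 hc)); rw [ha] at this; exact absurd this (by decide)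

/-- **THE PAIRWISE-ZERO-MEET STEP** (section language): `𝒰⁰∩𝒱⁰ ⊆ 𝒲¹ ∧ 𝒰⁰∩𝒲⁰ ⊆ 𝒱¹ ∧ 𝒱⁰∩𝒲⁰ ⊆ 𝒰¹` at `e` plus the listed `e`-free needs
give `threePartNT τ 𝒰 𝒱 𝒲 ≥ 0`. [this work] -/
theorem threePartNT_nonneg_of_pairwiseMeet (h𝒰 : IsUpperSet 𝒰) (h𝒱 : IsUpperSet 𝒱) (h𝒲 : IsUpperSet 𝒲)
    (hUV : ∀ T : Set ι, T \ {e} ∈ 𝒰 → T \ {e} ∈ 𝒱 → insert e T ∈ 𝒲)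
    (hUW : ∀ T : Set ι, T \ {e} ∈ 𝒰 → T \ {e} ∈ 𝒲 → insert e T ∈ 𝒱)
    (hVW : ∀ T : Set ι, T \ {e} ∈ 𝒱 → T \ {e} ∈ 𝒲 → insert e T ∈ 𝒰)
    (hN1 : 0 ≤ threePartNT τ (thrSet 𝒰 𝒱 𝒲 e (mk 0 0 1)) (thrSet 𝒰 𝒱 𝒲 e (mk 0 0 2)) (thrSet 𝒰 𝒱 𝒲 e (mk 2 2 0)))
    (hN2 : 0 ≤ threePartNT τ (thrSet 𝒰 𝒱 𝒲 e (mk 0 0 1)) (thrSet 𝒰 𝒱 𝒲 e (mk 0 1 0)) (thrSet 𝒰 𝒱 𝒲 e (mk 1 0 0)))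
    (hN3 : 0 ≤ threePartNT τ (thrSet 𝒰 𝒱 𝒲 e (mk 0 0 2)) (thrSet 𝒰 𝒱 𝒲 e (mk 0 2 0)) (thrSet 𝒰 𝒱 𝒲 e (mk 2 0 0)))
    (hN4 : 0 ≤ threePartNT τ (thrSet 𝒰 𝒱 𝒲 e (mk 0 1 0)) (thrSet 𝒰 𝒱 𝒲 e (mk 0 2 2)) (thrSet 𝒰 𝒱 𝒲 e (mk 2 0 1)))
    (hN5 : 0 ≤ threePartNT τ (thrSet 𝒰 𝒱 𝒲 e (mk 0 2 0)) (thrSet 𝒰 𝒱 𝒲 e (mk 1 0 0)) (thrSet 𝒰 𝒱 𝒲 e (mk 2 0 2)))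
    (hN6 : 0 ≤ threePartNT τ (thrSet 𝒰 𝒱 𝒲 e (mk 0 0 2)) (thrSet 𝒰 𝒱 𝒲 e (mk 0 1 0)) (thrSet 𝒰 𝒱 𝒲 e (mk 2 2 0)))
    (hN7 : 0 ≤ threePartNT τ (thrSet 𝒰 𝒱 𝒲 e (mk 0 1 0)) (thrSet 𝒰 𝒱 𝒲 e (mk 0 2 2)) (thrSet 𝒰 𝒱 𝒲 e (mk 2 0 0))) :
    0 ≤ threePartNT τ 𝒰 𝒱 𝒲 :=
  threePartNT_nonneg_of_pm0 e τ h𝒰 h𝒱 h𝒲 (pm_real e h𝒰 h𝒱 h𝒲 hUV hUW hVW) hN1 hN2 hN3 hN4 hN5 hN6 hN7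

end PMMain

end TypedSlice

end Summit.CriticalPhenomena.PercolationContinuityZ3.Theorems.ThreePartition
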